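import Summits.BirchSwinnertonDyer.Rank1Residual.X12.CMRamifiedAdditive
import Summits.BirchSwinnertonDyer.Rank1Residual.O5.HeegnerLogTransportThreeKrizLiGlue
import Literature.NumberTheory.EllipticCurves.KrizLi2019.EisensteinHeegnerLog
import Literature.NumberTheory.EllipticCurves.RootNumberTwistProofs
import Literature.NumberTheory.EllipticCurves.LFunctionPrimeCoeff
import Literature.NumberTheory.EllipticCurves.TamagawaPrimesEquivProofs
import Literature.NumberTheory.EllipticCurves.PAdicHeights
import Literature.NumberTheory.EllipticCurves.ComplexMultiplicationDeuringFrobeniusProofs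
import Literature.NumberTheory.DiophantineGeometry.LocalReduction
import Literature.NumberTheory.QuadraticFields.ImaginaryResiduePiForm
import HarnessLib

/-!
# O11 at `p = 7`, ROUTE U — four displayed binders of THEOREM U (T-U5) discharged for every CM
# curve with `d_K = −7` / every auxiliary field `K''`: `hns`, `h2`, `hsplit`, `hμ`

HONEST FRAMING (cell `bsd-cm`, run/shared/lean/pub/bsd-cm/, verbatim): the programme isolates, for
CM elliptic curves over `ℚ` of analytic rank `≤ 1`, classes on which the FULL BSD formula is
reduced — strictly by PUBLISHED theorems entering as named-fact binders — to ONE local problem at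
ONE prime, and then TYPES that residual problem. Seat `bsd-cm-ram` (generation 3), TARGET.md §2
T-U5 (the typed THEOREM U `RouteU.bsdp_of_thm120_of_rem310`, whose binders are all displayed).
THEOREMS ONLY; nothing asserted about any curve; no label moves.

Four of T-U5's binders hold for STRUCTURAL reasons on the whole Route-U population (every model
`W` of `49a1^{(D)}`, indeed every CM curve with `d_K = −7`, and every imaginary quadratic `K''`
with `d_{K''} < −4`, `7 ∤ d_{K''}` that embeds in `ℚ₇`), and are discharged here by name:

* `nsPointCount_seven_of_hasCM` — **`hns`: `|Ẽ^{ns}(𝔽₇)| = 7`**: a CM curve with `7 ∣ d_K` has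
  ADDITIVE reduction at `7` (tree `X12.addv_of_hasCM_of_cmRamified`: bad by Deuring/Serre–Tate,
  not multiplicative since CM curves are never multiplicative), so `a₇ = 0`
  (`LFunction_apply_eq_zero_of_hasAdditiveReductionAt`) and Kriz–Li's `|Ẽ^{ns}(𝔽₇)| = 7 + 0 − 0`.
* `not_hasSplitMultiplicativeReductionAtPrime_of_hasCM` — **`h2` (Kriz–Li Thm. 1.20 (2)): no
  prime of split multiplicative reduction**, for every CM curve (`not_mult_of_hasCM`).
* `ncard_primesOver_seven_eq_two_of_ringHom` — **`hsplit`: `7` splits in `K''`** as soon as `K''`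
  is (imaginary) quadratic with `7 ∤ d_{K''}` and embeds in `ℚ₇` (`ιp : K'' →+* ℚ₇`, a binder of
  T-U5 anyway; O5's `ncard_primesOver_eq_two_of_ringHom_padic`).
* `not_seven_dvd_unitsTorsionOrder` — **`hμ`: `7 ∤ w_{K''}`**, since `w_{K''} = 2` for
  `d_{K''} < −4` (`Quadratic.torsionOrder_eq_two_of_discr_lt_neg_four`).

Not discharged here (genuinely per-member or per-character): `hB` (Bernoulli units — T-U3′
certificates), `hg0`/`crd` (generator of level `0` ⟺ `n(D) = 0`), `hSW`/`hSd` (`7 ∤ #Ш` of `E_D`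
and of the twin — Prop. D), `hiv` (no `7`-torsion in `E_D(K'')`), `htamW` (`7 ∤ ∏ c_ℓ`; true for
every CM curve at `p ≥ 5` since additive Tamagawa numbers are `≤ 4`, but the tree's
`localTamagawaNumber_le_four_of_additive_rat` is conditional on two Néron-model named facts),
the character data `ψ`, `ω`, `ε_K` (`hss` is `RouteUTraceForm.hss_twist_cm7`).
References: [KrizLi2019] Thm. 1.20, Rem. 1.17, Rem. 1.21; [SilvermanAEC2009] VII.5, C.16;
[SilvermanATAEC1994] II.6.4.
-/

noncomputable section

open scoped Classical
open NumberField IsDedekindDomain IsDedekindDomain.HeightOneSpectrum Field WeierstrassCurve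
open Literature.NumberTheory.EllipticCurves Literature.NumberTheory.EllipticCurves.Rank1Residual
open Literature.NumberTheory.EllipticCurves.KrizLi2019

namespace Summit.BirchSwinnertonDyer.Rank1Residual.X12.O11.RouteU

/-! ## `hns`: `|Ẽ^{ns}(𝔽₇)| = 7` for a CM curve with `d_K = −7` -/

/-- **A CM curve with `7 ∣ d_K` (e.g. `d_K = −7`: every model of every `49a1^{(D)}`) has
`a₇ = 0`** — additive reduction at the ramified prime `7` (`X12.addv_of_hasCM_of_cmRamified`) and
`a_p = 0` at an additive prime (`LFunction_apply_eq_zero_of_hasAdditiveReductionAt`).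
[cite: SilvermanAEC2009, VII.5 and §C.16 (a_p = 0 at additive p)] [cite: SilvermanATAEC1994, Thm. II.6.4] -/
theorem lFunction_seven_eq_zero_of_hasCM (W : WeierstrassCurve ℚ) [W.IsElliptic] (hCM : W.HasCM)
    (hram : CMRamified W 7) : W.LFunction 7 = 0 := by
  haveI : Fact (Nat.Prime 7) := ⟨by norm_num⟩
  obtain ⟨hng, hnm⟩ := X12.addv_of_hasCM_of_cmRamified W 7 hCM (by norm_num) hram
  set v : HeightOneSpectrum (𝓞 ℚ) := (Rat.HeightOneSpectrum.primesEquiv (R := 𝓞 ℚ)).symm ⟨7, by norm_num⟩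
    with hvdef
  have hv7 : (Rat.HeightOneSpectrum.primesEquiv v : ℕ) = 7 := by rw [hvdef, Equiv.apply_symm_apply]
  have hng' : ¬ W.HasGoodReductionAt v :=
    fun h => hng ((hasGoodReductionAtPrime_primesEquiv_iff_holds W v 7 hv7).mpr h)
  have hnm' : ¬ W.HasMultiplicativeReductionAt v :=
    fun h => hnm ((hasMultiplicativeReductionAtPrime_primesEquiv_iff_holds W v 7 hv7).mpr h)
  have hadd : W.HasAdditiveReductionAt v := by
    rcases hasGoodReductionAt_or_hasMultiplicativeReductionAt_or_hasAdditiveReductionAt v W with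
      h | h | h
    · exact absurd h hng'
    · exact absurd h hnm'
    · exact h
  exact W.LFunction_apply_eq_zero_of_hasAdditiveReductionAt hv7 hadd (dvd_refl 7)

/-- **`hns` of T-U5 for every CM curve with `7 ∣ d_K`: `|Ẽ^{ns}(𝔽₇)| = 7`** in Kriz–Li's
normalisation (`KrizLi2019.nsPointCount W 7 = 7 + [good] − a₇ = 7 + 0 − 0`; Rem. 1.17).
[cite: KrizLi2019, Rem. 1.17 (p. 6) (|Ẽ^{ns}(𝔽_p)| at an additive prime)] -/
theorem nsPointCount_seven_of_hasCM (W : WeierstrassCurve ℚ) [W.IsElliptic] (hCM : W.HasCM)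
    (hram : CMRamified W 7) : KrizLi2019.nsPointCount W 7 = 7 := by
  haveI : Fact (Nat.Prime 7) := ⟨by norm_num⟩
  have hng : ¬ W.HasGoodReductionAtPrime 7 :=
    (X12.addv_of_hasCM_of_cmRamified W 7 hCM (by norm_num) hram).1
  unfold KrizLi2019.nsPointCount
  rw [dif_pos (by norm_num : Nat.Prime 7), lFunction_seven_eq_zero_of_hasCM W hCM hram, sub_zero]
  simp [hng]

/-- The `d_K = −7` form (ROUTE U / 𝒞₇: `cmFieldDiscrOfJ W.j = −7`). [cite: KrizLi2019, Rem. 1.17 (p. 6) and Rem. 1.21 (p. 8)] -/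
theorem nsPointCount_seven_of_cmFieldDiscr_eq (W : WeierstrassCurve ℚ) [W.IsElliptic]
    (hCM : W.HasCM) (hK : cmFieldDiscrOfJ W.j = -7) : KrizLi2019.nsPointCount W 7 = 7 :=
  nsPointCount_seven_of_hasCM W hCM (by rw [CMRamified, hK]; norm_num)

/-! ## `h2`: a CM curve has no prime of split multiplicative reduction -/

/-- **Hypothesis (2) of Kriz–Li Thm. 1.20 for every CM curve**: no prime of split multiplicative
reduction (CM curves have no multiplicative primes at all, Silverman *AT* II.6.4, tree
`not_mult_of_hasCM`). Exactly T-U5's binder `h2`. [cite: SilvermanATAEC1994, Thm. II.6.4 (PDF p. 148)]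
[cite: KrizLi2019, Thm. 1.20 (2) (p. 7)] -/
theorem not_hasSplitMultiplicativeReductionAtPrime_of_hasCM (W : WeierstrassCurve ℚ) [W.IsElliptic]
    (hCM : W.HasCM) :
    ∀ ℓ : ℕ, (hℓ : ℓ.Prime) →
      ¬ (haveI := Fact.mk hℓ; W.HasSplitMultiplicativeReductionAtPrime ℓ) := by
  intro ℓ hℓ h
  haveI := Fact.mk hℓ
  exact not_mult_of_hasCM W hCM ℓ h.hasMultiplicativeReductionAtPrime

/-! ## `hsplit`: `7` splits in an imaginary quadratic `K''` with `7 ∤ d_{K''}` that embeds in `ℚ₇` -/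

/-- **`hsplit` of T-U5 from the embedding binder `ιp`**: for `K` imaginary quadratic with
`7 ∤ d_K` and a ring map `ιp : K →+* ℚ₇`, exactly two primes of `𝓞 K` lie over `7` (O5's
`ncard_primesOver_eq_two_of_ringHom_padic`: `d_K` is a non-zero square in `ℚ₇`, decomposition
law). [folklore] -/
theorem ncard_primesOver_seven_eq_two_of_ringHom {K : Type} [Field K] [NumberField K]
    (hK : IsImaginaryQuadratic K) (hd : ¬ (7 : ℤ) ∣ NumberField.discr K) (ιp : K →+* ℚ_[7]) :
    ((Ideal.span {(7 : ℤ)}).primesOver (𝓞 K)).ncard = 2 := by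
  haveI : Fact (Nat.Prime 7) := ⟨by norm_num⟩
  exact O5.HeegnerLogTransport.ncard_primesOver_eq_two_of_ringHom_padic hK.1 (by norm_num)
    (by exact_mod_cast hd) ιp

/-! ## `hμ`: `7 ∤ w_{K''}` -/

/-- **`hμ` of T-U5**: for `K` imaginary quadratic with `d_K < −4`, `w_K = 2`, so `7 ∤ w_K`
(`Quadratic.torsionOrder_eq_two_of_discr_lt_neg_four`). [cite: Oesterle1988Gauss, II §1 p. 53] -/
theorem not_seven_dvd_unitsTorsionOrder {K : Type} [Field K] [NumberField K]
    (hK : IsImaginaryQuadratic K) (hd : NumberField.discr K < -4) :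
    ¬ 7 ∣ NumberField.Units.torsionOrder K := by
  rw [Literature.NumberTheory.QuadraticFields.Quadratic.torsionOrder_eq_two_of_discr_lt_neg_four hK.1 hd]
  decide

end Summit.BirchSwinnertonDyer.Rank1Residual.X12.O11.RouteU

end
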